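import Mathlib.GroupTheory.SpecificGroups.Cyclic
import Mathlib.GroupTheory.SpecificGroups.Dihedral
import Mathlib.GroupTheory.SpecificGroups.Quaternion
import Summits.MatrixMultiplication.OmegaCensus.CentreIndexFourTPP

/-!
# ω-census, family (b3): groups with centre of index `4` — `[G : Z(G)] = 4 ⇒ 2|S||T||U| ≤ 3|G|` for two-`3`-set TPP triples

HONEST FRAMING (pub-omega census; verbatim): lottery ticket; floor = certified bounds/negative ranges.
Census BOOKKEEPING around `CentreIndexFourTPP.lean` (`SmallComm.two_mul_volume_le`): (1) every group whose centre has index `4` satisfies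
`SmallComm [a, b]` for any non-commuting `a, b` (`G/Z(G)` has order `4` and is not cyclic, so squares and commutators are central; the four
cosets of `Z(G)` are `Z, aZ, bZ, abZ`, which gives "every commutator is `1` or `z`" and "the centraliser of a non-commuting pair is `Z(G)`");
hence the LAW `two_mul_volume_le_of_index_center`: `[G : Z(G)] = 4 ⇒ 2|S||T||U| ≤ 3|G| (= 2 Σ_χ χ(1)³)` for every TPP triple with
`|T|, |U| ≤ 3`, and no `⟨N, 3, 3⟩` in `G` when `|G| < 6N` (all orders of the sizes); (2) `SmallComm` passes from `Q` to `Q × A` (`A` abelian)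
and holds for `D₄ = DihedralGroup 4`, `Q₈ = QuaternionGroup 2` by finite checks, so the laws of `D4Box.lean` / `Q8Box.lean` (census R299/R300)
are instances.  Certified NEGATIVE ranges for single TPP triples; nothing here is progress on `ω`.
-/

open Finset
open Literature.Combinatorics.Additive

namespace Summit.MatrixMultiplication.OmegaCensus.CentreIndexFour

variable {G : Type*} [Group G]

/-! ## Groups with centre of index `4` satisfy `SmallComm` -/

section IndexFour

variable [Finite G] (h4 : (Subgroup.center G).index = 4)
include h4

omit [Finite G] in
/-- `|G / Z(G)| = 4`. [folklore] -/
theorem card_quot_center : Nat.card (G ⧸ Subgroup.center G) = 4 := by rw [← Subgroup.index_eq_card]; exact h4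

/-- Every square is central (`G/Z(G)`, of order `4`, is not cyclic, so it has exponent `2`). [folklore] -/
theorem sq_mem_center (g : G) : g * g ∈ Subgroup.center G := by
  have hcard := card_quot_center h4
  have hdvd : orderOf (g : G ⧸ Subgroup.center G) ∣ 2 ^ 2 := by
    have := orderOf_dvd_natCard (g : G ⧸ Subgroup.center G); rwa [hcard] at this
  obtain ⟨k, hk, hk'⟩ := (Nat.dvd_prime_pow Nat.prime_two).1 hdvd
  have hk2 : k ≠ 2 := by
    rintro rfl
    have hcyc : IsCyclic (G ⧸ Subgroup.center G) := isCyclic_of_orderOf_eq_card _ (by rw [hk', hcard]; norm_num)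
    have hcomm := (QuotientGroup.mk' (Subgroup.center G)).isMulCommutative_of_isCyclic_of_ker_le_center
      (by rw [QuotientGroup.ker_mk'])
    -- `G` is not commutative: its centre has index `4 ≠ 1` (inlined; the named form lives in `CentreIndexSixGroups`)
    have hne : ∃ a b : G, a * b ≠ b * a := by
      by_contra! hall
      have htop : Subgroup.center G = ⊤ := by
        rw [Subgroup.eq_top_iff']; intro x; rw [Subgroup.mem_center_iff]; intro g; exact hall g x
      rw [htop, Subgroup.index_top] at h4
      exact absurd h4 (by norm_num)
    obtain ⟨a, b, hab⟩ := hne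
    exact hab (hcomm.is_comm.comm a b)
  have h2 : orderOf (g : G ⧸ Subgroup.center G) ∣ 2 := by
    have hk1 : k ≤ 1 := by omega
    interval_cases k <;> rw [hk'] <;> norm_num
  rwa [orderOf_dvd_iff_pow_eq_one, pow_two, ← QuotientGroup.mk_mul, QuotientGroup.eq_one_iff] at h2

/-- Every commutator is central (`G/Z(G)` has exponent `2`, hence is commutative). [folklore] -/
theorem comm_mem_center (a b : G) : a * b * a⁻¹ * b⁻¹ ∈ Subgroup.center G := by
  have hsq : ∀ q : G ⧸ Subgroup.center G, q * q = 1 := by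
    intro q
    obtain ⟨g, rfl⟩ := QuotientGroup.mk_surjective q
    rw [← QuotientGroup.mk_mul, QuotientGroup.eq_one_iff]; exact sq_mem_center h4 g
  have hinv : ∀ q : G ⧸ Subgroup.center G, q⁻¹ = q := fun q => inv_eq_of_mul_eq_one_right (hsq q)
  have hcomm : ∀ p q : G ⧸ Subgroup.center G, p * q = q * p := fun p q => by
    calc p * q = (p * q)⁻¹ := (hinv _).symm
      _ = q⁻¹ * p⁻¹ := mul_inv_rev _ _
      _ = q * p := by rw [hinv, hinv]
  rw [← QuotientGroup.eq_one_iff]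
  simp only [QuotientGroup.mk_mul, QuotientGroup.mk_inv]
  rw [hcomm (a : G ⧸ Subgroup.center G) (b : G ⧸ Subgroup.center G)]
  group

/-- **Coset decomposition.** For any non-commuting `a, b`, every element is `c`, `a c`, `b c` or `a b c` with `c` central (`1, ā, b̄, āb̄`
are four distinct elements of the four-element group `G/Z(G)`). [folklore] -/
theorem exists_central_eq {a b : G} (hab : a * b ≠ b * a) (g : G) :
    ∃ c ∈ Subgroup.center G, g = c ∨ g = a * c ∨ g = b * c ∨ g = a * b * c := by
  classical
  haveI : Fintype (G ⧸ Subgroup.center G) := Fintype.ofFinite _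
  have hZ : ∀ {c : G}, c ∈ Subgroup.center G → ∀ x : G, x * c = c * x := fun hc => Subgroup.mem_center_iff.1 hc
  have na : a ∉ Subgroup.center G := fun ha => hab (hZ ha b).symm
  have nb : b ∉ Subgroup.center G := fun hb => hab (hZ hb a)
  have nab : a * b ∉ Subgroup.center G := fun h => hab (mul_left_cancel ((hZ h a).trans (mul_assoc a b a)))
  have nab' : a⁻¹ * b ∉ Subgroup.center G := fun h => hab (by
    calc a * b = a * (a * (a⁻¹ * b)) := by group
      _ = a * (a⁻¹ * b * a) := by rw [hZ h a]
      _ = b * a := by group)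
  have nbab : b⁻¹ * (a * b) ∉ Subgroup.center G := fun h => hab (by
    have e2 : b * a * b = a * b * b := by
      calc b * a * b = b * (b * (b⁻¹ * (a * b))) := by group
        _ = b * (b⁻¹ * (a * b) * b) := by rw [hZ h b]
        _ = a * b * b := by group
    exact (mul_right_cancel e2).symm)
  -- the four classes, as a finset of the quotient
  let s : Finset (G ⧸ Subgroup.center G) := {(1 : G ⧸ Subgroup.center G), (a : G ⧸ Subgroup.center G),
    (b : G ⧸ Subgroup.center G), ((a * b : G) : G ⧸ Subgroup.center G)}
  have d1 : (a : G ⧸ Subgroup.center G) ≠ 1 := fun e => na ((QuotientGroup.eq_one_iff a).1 e)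
  have d2 : (b : G ⧸ Subgroup.center G) ≠ 1 := fun e => nb ((QuotientGroup.eq_one_iff b).1 e)
  have d3 : ((a * b : G) : G ⧸ Subgroup.center G) ≠ 1 := fun e => nab ((QuotientGroup.eq_one_iff _).1 e)
  have d4 : (a : G ⧸ Subgroup.center G) ≠ (b : G ⧸ Subgroup.center G) := fun e => nab' (QuotientGroup.eq.1 e)
  have d5 : (a : G ⧸ Subgroup.center G) ≠ ((a * b : G) : G ⧸ Subgroup.center G) := fun e =>
    nb (by have := QuotientGroup.eq.1 e; rwa [inv_mul_cancel_left] at this)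
  have d6 : (b : G ⧸ Subgroup.center G) ≠ ((a * b : G) : G ⧸ Subgroup.center G) := fun e => nbab (QuotientGroup.eq.1 e)
  have hs : #s = 4 := by
    simp only [s]
    rw [card_insert_of_notMem, card_insert_of_notMem, card_insert_of_notMem, card_singleton]
    · simpa using d6
    · simp only [mem_insert, mem_singleton, not_or]; exact ⟨d4, d5⟩
    · simp only [mem_insert, mem_singleton, not_or]; exact ⟨d1.symm, d2.symm, d3.symm⟩
  have hsu : s = univ := Finset.eq_univ_of_card s (by rw [hs, ← Nat.card_eq_fintype_card, card_quot_center h4])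
  have hg : (g : G ⧸ Subgroup.center G) ∈ s := by rw [hsu]; exact mem_univ _
  simp only [s, mem_insert, mem_singleton] at hg
  rcases hg with e | e | e | e
  · exact ⟨g, (QuotientGroup.eq_one_iff g).1 e, Or.inl rfl⟩
  · refine ⟨a⁻¹ * g, QuotientGroup.eq.1 e.symm, Or.inr (Or.inl (by group))⟩
  · refine ⟨b⁻¹ * g, QuotientGroup.eq.1 e.symm, Or.inr (Or.inr (Or.inl (by group)))⟩
  · refine ⟨(a * b)⁻¹ * g, QuotientGroup.eq.1 e.symm, Or.inr (Or.inr (Or.inr (by group)))⟩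

/-- **`[G : Z(G)] = 4 ⇒ SmallComm`.** With `z = a b a⁻¹ b⁻¹` for any non-commuting `a, b`: `z` is a central involution `≠ 1`, every
commutator is `1` or `z`, and the centraliser of a non-commuting pair is central. [folklore] -/
theorem exists_smallComm : ∃ z : G, SmallComm z := by
  have hne : ∃ a b : G, a * b ≠ b * a := by
    by_contra! hall
    have htop : Subgroup.center G = ⊤ := by
      rw [Subgroup.eq_top_iff']; intro x; rw [Subgroup.mem_center_iff]; intro g; exact hall g x
    rw [htop, Subgroup.index_top] at h4
    exact absurd h4 (by norm_num)
  obtain ⟨a, b, hab⟩ := hne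
  have hZ : ∀ {c : G}, c ∈ Subgroup.center G → ∀ x : G, x * c = c * x := fun hc => Subgroup.mem_center_iff.1 hc
  set z := a * b * a⁻¹ * b⁻¹ with hz
  have hzc : ∀ g : G, g * z = z * g := hZ (comm_mem_center h4 a b)
  have hz1 : z ≠ 1 := fun e => hab (by
    calc a * b = z * (b * a) := by rw [hz]; group
      _ = b * a := by rw [e, one_mul])
  have hzz : z * z = 1 := by
    have haa : ∀ g : G, g * (a * a) = a * a * g := hZ (sq_mem_center h4 a)
    calc z * z = z * a * a⁻¹ * z := by group
      _ = a * z * a⁻¹ * z := by rw [← hzc a]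
      _ = a * a * b * (a * a)⁻¹ * b⁻¹ := by rw [hz]; group
      _ = b * (a * a) * (a * a)⁻¹ * b⁻¹ := by rw [← haa b]
      _ = 1 := by group
  have e_ab : a * b = b * a * z := by
    calc a * b = z * (b * a) := by rw [hz]; group
      _ = b * a * z := (hzc (b * a)).symm
  have e_ba : b * a = a * b * z := by
    calc b * a = b * a * (z * z) := by rw [hzz, mul_one]
      _ = b * a * z * z := by group
      _ = a * b * z := by rw [← e_ab]
  have e_a_ab : a * (a * b) = a * b * a * z := by
    calc a * (a * b) = a * (b * a * z) := by rw [← e_ab]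
      _ = a * b * a * z := by group
  have e_ab_a : a * b * a = a * (a * b) * z := by
    calc a * b * a = a * (b * a) := by group
      _ = a * (a * b * z) := by rw [e_ba]
      _ = a * (a * b) * z := by group
  have e_b_ab : b * (a * b) = a * b * b * z := by
    calc b * (a * b) = b * a * b := by group
      _ = a * b * z * b := by rw [e_ba]
      _ = a * b * (z * b) := by group
      _ = a * b * (b * z) := by rw [← hzc b]
      _ = a * b * b * z := by group
  have e_ab_b : a * b * b = b * (a * b) * z := by
    calc a * b * b = a * b * b * (z * z) := by rw [hzz, mul_one]
      _ = a * b * b * z * z := by group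
      _ = b * (a * b) * z := by rw [← e_b_ab]
  refine ⟨z, hz1, hzz, fun g h' => ?_, fun a' b' t hab' hat hbt g => ?_⟩
  · -- every commutator is `1` or `z`
    obtain ⟨c, hc, hg⟩ := exists_central_eq h4 hab g
    obtain ⟨c', hc', hh⟩ := exists_central_eq h4 hab h'
    have hcc := hZ hc
    have hcc' := hZ hc'
    have M : ∀ p q : G, p * c * (q * c') = p * q * (c * c') := fun p q => by
      calc p * c * (q * c') = p * (c * q) * c' := by group
        _ = p * (q * c) * c' := by rw [← hcc q]
        _ = p * q * (c * c') := by group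
    have L : ∀ p q : G, q * p * (c * c') = q * c' * (p * c) := fun p q => by
      calc q * p * (c * c') = q * p * (c' * c) := by rw [← hcc c']
        _ = q * (p * c') * c := by group
        _ = q * (c' * p) * c := by rw [hcc' p]
        _ = q * c' * (p * c) := by group
    have red : ∀ p q : G, (p * q = q * p ∨ p * q = q * p * z) →
        p * c * (q * c') = q * c' * (p * c) ∨ p * c * (q * c') = q * c' * (p * c) * z := by
      intro p q hpq
      rcases hpq with e | e
      · left; rw [M, e, L]
      · right
        calc p * c * (q * c') = q * p * z * (c * c') := by rw [M, e]
          _ = q * p * (z * (c * c')) := by group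
          _ = q * p * (c * c' * z) := by rw [← hzc (c * c')]
          _ = q * p * (c * c') * z := by group
          _ = q * c' * (p * c) * z := by rw [L]
    rcases hg with hg | hg | hg | hg <;> rcases hh with hh | hh | hh | hh <;> rw [hg, hh]
    · simpa only [one_mul] using red 1 1 (Or.inl rfl)
    · simpa only [one_mul] using red 1 a (Or.inl (by simp))
    · simpa only [one_mul] using red 1 b (Or.inl (by simp))
    · simpa only [one_mul] using red 1 (a * b) (Or.inl (by simp))
    · simpa only [one_mul] using red a 1 (Or.inl (by simp))
    · exact red a a (Or.inl rfl)
    · exact red a b (Or.inr e_ab)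
    · exact red a (a * b) (Or.inr e_a_ab)
    · simpa only [one_mul] using red b 1 (Or.inl (by simp))
    · exact red b a (Or.inr e_ba)
    · exact red b b (Or.inl rfl)
    · exact red b (a * b) (Or.inr e_b_ab)
    · simpa only [one_mul] using red (a * b) 1 (Or.inl (by simp))
    · exact red (a * b) a (Or.inr e_ab_a)
    · exact red (a * b) b (Or.inr e_ab_b)
    · exact red (a * b) (a * b) (Or.inl rfl)
  · -- the centraliser of the non-commuting pair `a', b'` is central: decompose `g` along `a', b'`
    obtain ⟨c, hc, hg⟩ := exists_central_eq h4 hab' g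
    have hct : c * t = t * c := (hZ hc t).symm
    rcases hg with hg | hg | hg | hg <;> rw [hg]
    · exact hct
    · calc a' * c * t = a' * (c * t) := by group
        _ = a' * (t * c) := by rw [hct]
        _ = a' * t * c := by group
        _ = t * a' * c := by rw [hat]
        _ = t * (a' * c) := by group
    · calc b' * c * t = b' * (c * t) := by group
        _ = b' * (t * c) := by rw [hct]
        _ = b' * t * c := by group
        _ = t * b' * c := by rw [hbt]
        _ = t * (b' * c) := by group
    · calc a' * b' * c * t = a' * b' * (c * t) := by group
        _ = a' * b' * (t * c) := by rw [hct]
        _ = a' * (b' * t) * c := by group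
        _ = a' * (t * b') * c := by rw [hbt]
        _ = a' * t * b' * c := by group
        _ = t * a' * b' * c := by rw [hat]
        _ = t * (a' * b' * c) := by group

end IndexFour

/-- **LAW (census): `[G : Z(G)] = 4 ⇒ 2|S||T||U| ≤ 3|G|`** for every TPP triple `(S, T, U)` of the finite group `G` with `|T| ≤ 3`,
`|U| ≤ 3` (`3|G|/2 = Σ_χ χ(1)³` for these groups: no two-`3`-set TPP triple beats the sum of the cubes of the character degrees). [folklore] -/
theorem two_mul_volume_le_of_index_center [Fintype G] [DecidableEq G] (h4' : (Subgroup.center G).index = 4) {S T U : Finset G}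
    (htpp : TripleProductProperty S T U) (hT : #T ≤ 3) (hU : #U ≤ 3) : 2 * (#S * #T * #U) ≤ 3 * Fintype.card G := by
  obtain ⟨z, hz⟩ := exists_smallComm h4'
  exact hz.two_mul_volume_le htpp hT hU

/-- **`[G : Z(G)] = 4` and `|G| < 6N` ⇒ no `⟨N, 3, 3⟩` in `G`**, in every ordering of the sizes. [folklore] -/
theorem not_realizesTPP_three_three_of_index_center [Fintype G] [DecidableEq G] (h4' : (Subgroup.center G).index = 4) (N : ℕ)
    (hlt : Fintype.card G < 6 * N) :
    ¬ Literature.Computability.AlgebraicComplexity.RealizesTPP G N 3 3 ∧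
      ¬ Literature.Computability.AlgebraicComplexity.RealizesTPP G 3 N 3 ∧
        ¬ Literature.Computability.AlgebraicComplexity.RealizesTPP G 3 3 N := by
  obtain ⟨z, hz⟩ := exists_smallComm h4'
  exact hz.not_realizesTPP_three_three N hlt



/-! ## Closure under `× A` (`A` abelian) -/

/-- `SmallComm` passes from `Q` to `Q × A` for every abelian `A` (with `z ↦ (z, 1)`). [folklore] -/
theorem SmallComm.prod {Q : Type*} [Group Q] {z : Q} (h : SmallComm z) (A : Type*) [CommGroup A] : SmallComm ((z, 1) : Q × A) := by
  refine ⟨fun e => h.ne_one (by simpa using congrArg Prod.fst e), Prod.ext (by simpa using h.sq) (by simp), fun a b => ?_,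
    fun a b t hab hat hbt g => ?_⟩
  · rcases h.comm_or a.1 b.1 with e | e
    · exact Or.inl (Prod.ext e (mul_comm _ _))
    · exact Or.inr (Prod.ext (by simpa using e) (by simp [mul_comm]))
  · have hab' : a.1 * b.1 ≠ b.1 * a.1 := fun e => hab (Prod.ext e (mul_comm _ _))
    have hq := h.central_of a.1 b.1 t.1 hab' (by simpa using congrArg Prod.fst hat) (by simpa using congrArg Prod.fst hbt)
    exact Prod.ext (hq g.1) (mul_comm _ _)

/-! ## Instances `D₄`, `Q₈` and sample laws / cells -/

/-- `D₄ = DihedralGroup 4` satisfies `SmallComm` with `z = r²` (finite check). [folklore] -/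
theorem smallComm_dihedral4 : SmallComm (DihedralGroup.r 2 : DihedralGroup 4) :=
  ⟨by decide, by decide, by decide, by decide⟩

/-- `Q₈ = QuaternionGroup 2` satisfies `SmallComm` with `z = a 2 = −1` (finite check). [folklore] -/
theorem smallComm_quaternion : SmallComm (QuaternionGroup.a 2 : QuaternionGroup 2) :=
  ⟨by decide, by decide, by decide, by decide⟩

/-- **Law for `D₄ × A`** (supersedes the box-constant route of `D4Box.lean`): `2|S||T||U| ≤ 3·|D₄ × A|` for TPP triples with
`|T|, |U| ≤ 3`, every finite abelian `A`. [folklore] -/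
theorem two_mul_volume_le_D4_prod {A : Type*} [CommGroup A] [Fintype A] [DecidableEq A]
    {S T U : Finset (DihedralGroup 4 × A)} (htpp : TripleProductProperty S T U) (hT : #T ≤ 3) (hU : #U ≤ 3) :
    2 * (#S * #T * #U) ≤ 3 * Fintype.card (DihedralGroup 4 × A) :=
  (smallComm_dihedral4.prod A).two_mul_volume_le htpp hT hU

/-- **Law for `Q₈ × A`**: the same for `QuaternionGroup 2 × A`. [folklore] -/
theorem two_mul_volume_le_Q8_prod {A : Type*} [CommGroup A] [Fintype A] [DecidableEq A]
    {S T U : Finset (QuaternionGroup 2 × A)} (htpp : TripleProductProperty S T U) (hT : #T ≤ 3) (hU : #U ≤ 3) :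
    2 * (#S * #T * #U) ≤ 3 * Fintype.card (QuaternionGroup 2 × A) :=
  (smallComm_quaternion.prod A).two_mul_volume_le htpp hT hU

/-- Sample cell at order `48`: `D₄ × C₆` realizes no `⟨9, 3, 3⟩` in any order of the sizes (`48 < 54`; cf. `D4Box.D4xC6_no_tpp_9_3_3_all_orders`). [folklore] -/
theorem D4xC6_no_tpp_9_3_3 :
    ¬ Literature.Computability.AlgebraicComplexity.RealizesTPP (DihedralGroup 4 × Multiplicative (ZMod 6)) 9 3 3 ∧
      ¬ Literature.Computability.AlgebraicComplexity.RealizesTPP (DihedralGroup 4 × Multiplicative (ZMod 6)) 3 9 3 ∧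
        ¬ Literature.Computability.AlgebraicComplexity.RealizesTPP (DihedralGroup 4 × Multiplicative (ZMod 6)) 3 3 9 :=
  (smallComm_dihedral4.prod (Multiplicative (ZMod 6))).not_realizesTPP_three_three 9 (by simp [Fintype.card_prod, DihedralGroup.card])

end Summit.MatrixMultiplication.OmegaCensus.CentreIndexFour
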